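import Summits.CriticalPhenomena.PercolationContinuityZ3.Theses.PercTwoPointDecay
import Summits.CriticalPhenomena.PercolationContinuityZ3.Theorems.PercNearOneGluingNoHeavyLowerTailCSHTheoremOne
import Summits.CriticalPhenomena.PercolationContinuityZ3.Theorems.FreeBoxPowerSaving.Negative.FreeBoxPowerSavingOneArm
import Literature.Probability.Percolation.TwoPointFunction
import HarnessLib

/-!
# `PercTwoPointDecay.CritBallAverageDecayOfSubs` (stmt-CriticalPhenomena-17863) — SETTLED after continuity

Item `stmt-CriticalPhenomena-17863` of route `CriticalPhenomena/PercTwoPointDecay` (support (split glue)): `FreeSusceptibilityPowerSaving → BoxGluing → CritBallAverageDecay`.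

PORT of the strategist's kernel-checked `Cruxes/CritBallAverageDecay/PercTwoPointDecayCritBallAverageDecaySplit.lean` (`critBallAverageDecay_of_subs`: `π_n² ≤ C|Λ_n|⁻¹ Σ τ^{Λ_{Kn}} ≤ M n^{−1/2}`, hence `π_{p_c}(n) ≤ √M n^{−1/4}`, and the landed shell summation `FreeBoxPowerSavingNegative.sum_tau_box_le_of_oneArm_rpow` at `s = 1/4` gives X_A with `a = 1/2`), typed against route PercTwoPointDecay's spellings of the two pieces.  p205010 is NOT used.

builds on p205010 (kernel theorem, internal audit signed; external expert review pending) — USED (`CSH.percolationContinuityZ3_holds`).  RSW3 lane, lead gen 28 (prover-prim-rsw3-lead-g28-0):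
'after continuity — the ledger harvest'.
References: G. Kozma, N. Nitzan (2024), Thm. 6 / Conj. 3 [KozmaNitzan2024]; G. Grimmett, *Percolation* (1999), §8 [GrimmettPercolation1999].
-/

noncomputable section

namespace Summit.CriticalPhenomena.PercolationContinuityZ3.Theorems

namespace PercTwoPointDecayCritBallAverageDecayOfSubs

open MeasureTheory Literature.Probability.Percolation Literature.Probability.LatticeModels
open Finset
open Summit.CriticalPhenomena.PercolationContinuityZ3.Theses.PercTwoPointDecay (CritBallAverageDecay FreeSusceptibilityPowerSaving BoxGluing)
open Summit.CriticalPhenomena.PercolationContinuityZ3.FreeBoxPowerSavingNegative (sum_tau_box_le_of_oneArm_rpow)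

/-- **S(1/2) ∧ BoxGluing ⟹ `π_{p_c}(n)² ≤ M n^{-1/2}`** for all `n ≥ 1`, with `M = C |C'| K^{5/2} ≥ 0`
(box inclusion `Λ_n ⊆ Λ_{Kn}`, `|Λ_n| = (2n+1)³ ≥ n³`). [folklore] -/
theorem oneArmProb_sq_le_of_subs (hS : FreeSusceptibilityPowerSaving) (hB : BoxGluing) :
    ∃ M : ℝ, 0 ≤ M ∧ ∀ n : ℕ, 1 ≤ n →
      (bondPercolation (zdGraph 3) (criticalProbI 3)).real (siteToBoundary 3 n) ^ 2 ≤
        M * (n : ℝ) ^ (-(1 / 2 : ℝ)) := by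
  obtain ⟨C', hS⟩ := hS
  obtain ⟨C, K, hC, hK, hB⟩ := hB
  set μ := bondPercolation (zdGraph 3) (criticalProbI 3) with hμ
  set M : ℝ := C * |C'| * (K : ℝ) ^ ((5 : ℝ) / 2) with hM
  have hM0 : 0 ≤ M := by positivity
  refine ⟨M, hM0, fun n hn => ?_⟩
  have hn1 : (1 : ℝ) ≤ n := by exact_mod_cast hn
  have hn0 : (0 : ℝ) < n := by linarith
  have hKn : 1 ≤ K * n := by
    calc 1 = 1 * 1 := by ring
      _ ≤ K * n := Nat.mul_le_mul hK hn
  -- restricted sum over Λ_n ≤ free sum over Λ_{Kn} ≤ |C'| (Kn)^{5/2}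
  have hsub : box 3 n ⊆ box 3 (K * n) := box_mono 3 (by nlinarith)
  have hfree : ∑ x ∈ box 3 n, μ.real (openConnIn (↑(box 3 (K * n)) : Set (Site 3)) 0 x) ≤
      |C'| * ((K : ℝ) ^ ((5 : ℝ) / 2) * (n : ℝ) ^ ((5 : ℝ) / 2)) := by
    calc ∑ x ∈ box 3 n, μ.real (openConnIn (↑(box 3 (K * n)) : Set (Site 3)) 0 x)
        ≤ ∑ x ∈ box 3 (K * n), μ.real (openConnIn (↑(box 3 (K * n)) : Set (Site 3)) 0 x) :=
          Finset.sum_le_sum_of_subset_of_nonneg hsub fun _ _ _ => measureReal_nonneg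
      _ ≤ C' * (((K * n : ℕ) : ℝ)) ^ ((5 : ℝ) / 2) := hS (K * n) hKn
      _ ≤ |C'| * (((K * n : ℕ) : ℝ)) ^ ((5 : ℝ) / 2) :=
          mul_le_mul_of_nonneg_right (le_abs_self C') (Real.rpow_nonneg (by positivity) _)
      _ = |C'| * ((K : ℝ) ^ ((5 : ℝ) / 2) * (n : ℝ) ^ ((5 : ℝ) / 2)) := by
          push_cast; rw [Real.mul_rpow (by positivity) (by positivity)]
  have hcard : ((box 3 n).card : ℝ) = (2 * (n : ℝ) + 1) ^ 3 := by
    rw [card_box]; push_cast; ring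
  have hcard_pos : (0 : ℝ) < (box 3 n).card := by rw [hcard]; positivity
  have hcard_ge : (n : ℝ) ^ (3 : ℝ) ≤ (box 3 n).card := by
    have h3 : (n : ℝ) ^ (3 : ℝ) = (n : ℝ) ^ (3 : ℕ) := by exact_mod_cast Real.rpow_natCast (n : ℝ) 3
    rw [hcard, h3]
    exact pow_le_pow_left₀ hn0.le (by linarith) 3
  have hn52 : (n : ℝ) ^ ((5 : ℝ) / 2) = (n : ℝ) ^ (3 : ℝ) * (n : ℝ) ^ (-(1 / 2 : ℝ)) := by
    rw [← Real.rpow_add hn0]; norm_num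
  calc μ.real (siteToBoundary 3 n) ^ 2
      ≤ C * ((box 3 n).card : ℝ)⁻¹ *
          ∑ x ∈ box 3 n, μ.real (openConnIn (↑(box 3 (K * n)) : Set (Site 3)) 0 x) := hB n hn
    _ ≤ C * ((box 3 n).card : ℝ)⁻¹ * (|C'| * ((K : ℝ) ^ ((5 : ℝ) / 2) * (n : ℝ) ^ ((5 : ℝ) / 2))) :=
          mul_le_mul_of_nonneg_left hfree (by positivity)
    _ = M * (((box 3 n).card : ℝ)⁻¹ * (n : ℝ) ^ (3 : ℝ)) * (n : ℝ) ^ (-(1 / 2 : ℝ)) := by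
          rw [hM, hn52]; ring
    _ ≤ M * 1 * (n : ℝ) ^ (-(1 / 2 : ℝ)) := by
          have h1 : ((box 3 n).card : ℝ)⁻¹ * (n : ℝ) ^ (3 : ℝ) ≤ 1 := by
            rw [inv_mul_le_iff₀ hcard_pos, mul_one]; exact hcard_ge
          exact mul_le_mul_of_nonneg_right (mul_le_mul_of_nonneg_left h1 hM0)
            (Real.rpow_nonneg hn0.le _)
    _ = M * (n : ℝ) ^ (-(1 / 2 : ℝ)) := by ring

/-- **S(1/2) ∧ BoxGluing ⟹ a one-arm RATE at `p_c(ℤ³)`**: `π_{p_c}(m) = oneArmProb 3 (criticalProbI 3) m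
≤ D m^{-1/4}` for all `m ≥ 1` (square root of `oneArmProb_sq_le_of_subs`). In particular the two pieces
together already give `θ(p_c) = 0` (`θ ≤ π_m → 0`); separately neither does. [folklore] -/
theorem oneArmProb_le_of_subs (hS : FreeSusceptibilityPowerSaving) (hB : BoxGluing) :
    ∃ D : ℝ, 0 ≤ D ∧ ∀ m : ℕ, 1 ≤ m →
      oneArmProb 3 (criticalProbI 3) m ≤ D * (m : ℝ) ^ (-(1 / 4 : ℝ)) := by
  obtain ⟨M, hM0, h2⟩ := oneArmProb_sq_le_of_subs hS hB
  refine ⟨Real.sqrt M, Real.sqrt_nonneg M, fun m hm => ?_⟩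
  have hm0 : (0 : ℝ) < m := by exact_mod_cast hm
  have hπ0 : 0 ≤ oneArmProb 3 (criticalProbI 3) m := measureReal_nonneg
  have h2m : oneArmProb 3 (criticalProbI 3) m ^ 2 ≤ M * (m : ℝ) ^ (-(1 / 2 : ℝ)) := h2 m hm
  have hsq : (Real.sqrt M * (m : ℝ) ^ (-(1 / 4 : ℝ))) ^ 2 = M * (m : ℝ) ^ (-(1 / 2 : ℝ)) := by
    rw [mul_pow, Real.sq_sqrt hM0, ← Real.rpow_natCast ((m : ℝ) ^ (-(1 / 4 : ℝ))) 2,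
      ← Real.rpow_mul hm0.le]
    norm_num
  have hrhs0 : 0 ≤ Real.sqrt M * (m : ℝ) ^ (-(1 / 4 : ℝ)) :=
    mul_nonneg (Real.sqrt_nonneg _) (Real.rpow_nonneg hm0.le _)
  exact (pow_le_pow_iff_left₀ hπ0 hrhs0 two_ne_zero).1 (h2m.trans_eq hsq.symm)

/-- **SPLIT GLUE `X_A ⇐ S(1/2) ∧ BoxGluing`** (`route edit --split CritBallAverageDecay --glue-by` this):
the one-arm rate `π_{p_c}(m) ≤ D m^{-1/4}` (`oneArmProb_le_of_subs`) fed to the landed shell summation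
`FreeBoxPowerSavingNegative.sum_tau_box_le_of_oneArm_rpow` (two disjoint boxes + BK, `τ(0,z) ≤ π(⌊(‖z‖-1)/2⌋)²`;
shells `|∂Λ_k| ≤ 54 k²`) at `s = 1/4` gives `Σ_{z ∈ Λ_R} τ_{p_c}(0,z) ≤ (125 + 864 D²) R^{3 - 1/2}` for `R ≥ 1`,
i.e. `CritBallAverageDecay` with `a = 1/2`, `C = 125 + 864 D²`. [folklore] -/
theorem critBallAverageDecay_of_subs (hS : FreeSusceptibilityPowerSaving) (hB : BoxGluing) :
    CritBallAverageDecay := by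
  obtain ⟨D, _hD0, harm⟩ := oneArmProb_le_of_subs hS hB
  refine ⟨1 / 2, 125 + 864 * D ^ 2, by norm_num, fun R hR => ?_⟩
  have hsum := sum_tau_box_le_of_oneArm_rpow (criticalProbI 3) (C := D) (s := 1 / 4)
    (by norm_num) (by norm_num) harm hR
  have hexp : (3 : ℝ) - 2 * (1 / 4) = 3 - 1 / 2 := by norm_num
  simpa only [tau_def, hexp] using hsum

/-- **`PercTwoPointDecay.CritBallAverageDecayOfSubs` (stmt-CriticalPhenomena-17863), settled.**  `fun hS hB => critBallAverageDecay_of_subs hS hB` (ported strategist glue, `a = 1/2`).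
[cite: KozmaNitzan2024, Thm. 6 with Conj. 3 (p. 15)] -/
theorem critBallAverageDecayOfSubs_proof : Summit.CriticalPhenomena.PercolationContinuityZ3.Theses.PercTwoPointDecay.CritBallAverageDecayOfSubs := by
  intro hS hB
  exact critBallAverageDecay_of_subs hS hB

end PercTwoPointDecayCritBallAverageDecayOfSubs

end Summit.CriticalPhenomena.PercolationContinuityZ3.Theorems

end
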